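import Summits.Ventures.HodgeRepro2.WeilCoproduct

/-!
# A2 annex — the Lefschetz operators of the twelve-plane model: `L`, `Λ`, the number operator, and the commutator `[Λ, L] = (|ι| − k)` on `⋀^k`

Cell pub-hodge-repro2, seat p6 (Tier-4 sub-claim A2, the Lefschetz (1,1) + Gysin step).

Paragraph (A9) of route/T4-A2-p6.md (the Lieberman variant of Theorem A) uses HARD LEFSCHETZ on the
abelian variety `B` (Voisin, *Hodge Theory and Complex Algebraic Geometry I*, Theorem 6.25, held copy
p0125 l. 37 – p0126 l. 3, the section's E40) as DATA: for the Kähler class `θ`, cup product with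
`θ^{n−k}` is an isomorphism `H^k(B) → H^{2n−k}(B)`, `n = dim B`. In p5's exterior-algebra model of
`H^*(B, ℂ)` (`WeilPlanes.A ι = ExteriorAlgebra ℂ (ι × Bool → ℂ)`, `2|ι| = 2 dim B`, the planes `p ∈ ι`
with generators `a_p = gen (p, false)`, `b_p = gen (p, true)`, `E_p = a_p ∧ b_p`), the class is
`θ = Σ_p c_p E_p` (`WeilPlanes.theta c`). This file sets up the operators of the sl₂-style proof that
the Lefschetz map of the MODEL is bijective for EVERY coefficient vector with all `c_p ≠ 0` (Kähler
or not); the bijectivity itself is in `A2HardLefschetzMain`.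

* `lef c` — the Lefschetz operator `L = θ ∧ ·` (left multiplication by `theta c`);
* `lamAt p` — the plane contraction `Λ_p = ι_{b_p^*} ∘ ι_{a_p^*}` (two `CliffordAlgebra.contractLeft`s,
  p5's `WeilIntegral.contr`), with `Λ_p (E_p) = 1`;
* `lam c` — the dual Lefschetz operator `Λ = Σ_p c_p⁻¹ Λ_p`;
* `numOp` — the number operator `Σ_j gen j ∧ ι_{j^*}`, which is `k` on `⋀^k` (`numOp_eq_smul`);
* the degree bookkeeping: a contraction maps `⋀^{k+1}` into `⋀^k` and kills `⋀^0`;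
* THE COMMUTATOR: for `x ∈ ⋀^k` and all `c_p ≠ 0`, `Λ (L x) − L (Λ x) = (|ι| − k) • x`
  (`lam_lef_sub_lef_lam`) — the flat Kähler identity `[L, Λ] = (k − n)` on `k`-forms, proved plane by
  plane from `contr_gen_mul` (`Λ_q` commutes with `E_p ∧ ·` for `q ≠ p`; for `q = p` the commutator is
  `1 − (the number of generators of the plane `p` present)`).

Everything is algebra of the model; nothing about varieties is asserted (the identification
`H^*(B, ℂ) = ⋀^* H^1` is A0.3 (ii) of the prose).
-/

namespace Summit.Ventures.HodgeRepro2.A2HardLefschetzOps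

open WeilPlanes WeilIntegral WeilCoproduct

variable {ι : Type*} [DecidableEq ι]

/-- The Lefschetz operator of the model: left multiplication by `θ = Σ_p c_p E_p`. -/
noncomputable def lef [Fintype ι] (c : ι → ℂ) : A ι →ₗ[ℂ] A ι :=
  LinearMap.mulLeft ℂ (theta c)

/-- The plane contraction `Λ_p = ι_{b_p^*} ∘ ι_{a_p^*}` (first contract `a_p = gen (p, false)`, then
`b_p = gen (p, true)`), so that `Λ_p (E_p) = 1`. -/
noncomputable def lamAt (p : ι) : A ι →ₗ[ℂ] A ι :=
  contr (dual (p, true)) ∘ₗ contr (dual (p, false))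

/-- The dual Lefschetz operator `Λ = Σ_p c_p⁻¹ Λ_p`. -/
noncomputable def lam [Fintype ι] (c : ι → ℂ) : A ι →ₗ[ℂ] A ι :=
  ∑ p, (c p)⁻¹ • lamAt p

/-- The number operator `Σ_j gen j ∧ ι_{j^*}` over all `2|ι|` generators; it acts as `k` on `⋀^k`. -/
noncomputable def numOp [Fintype ι] : A ι →ₗ[ℂ] A ι :=
  ∑ j : Gen ι, LinearMap.mulLeft ℂ (gen j) ∘ₗ contr (dual j)

/-- `L x = θ ∧ x`. -/
@[simp] theorem lef_apply [Fintype ι] (c : ι → ℂ) (x : A ι) : lef c x = theta c * x := rfl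

omit [DecidableEq ι] in
/-- `Λ_p x = ι_{b_p^*} (ι_{a_p^*} x)`. -/
theorem lamAt_apply (p : ι) (x : A ι) :
    lamAt p x = contr (dual (p, true)) (contr (dual (p, false)) x) := rfl

omit [DecidableEq ι] in
/-- `Λ x = Σ_p c_p⁻¹ • Λ_p x`. -/
theorem lam_apply [Fintype ι] (c : ι → ℂ) (x : A ι) : lam c x = ∑ p, (c p)⁻¹ • lamAt p x := by
  simp [lam, LinearMap.sum_apply]

/-- The number operator unfolded: `Σ_j gen j ∧ ι_{j^*} x`. -/
theorem numOp_apply [Fintype ι] (x : A ι) : numOp x = ∑ j : Gen ι, gen j * contr (dual j) x := by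
  simp [numOp, LinearMap.sum_apply]

/-- The dual basis vector `j^*` on the basis vector `j'`. -/
theorem dual_single (j j' : Gen ι) : dual j (Pi.single j' (1 : ℂ)) = if j = j' then 1 else 0 := by
  simp [dual, LinearMap.proj_apply, Pi.single_apply]

/-- `j^*(j) = 1`. -/
theorem dual_single_self (j : Gen ι) : dual j (Pi.single j (1 : ℂ)) = 1 := by
  simp [dual_single]

/-- `j^*(j') = 0` for `j ≠ j'`. -/
theorem dual_single_of_ne {j j' : Gen ι} (h : j ≠ j') : dual j (Pi.single j' (1 : ℂ)) = 0 := by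
  simp [dual_single, h]

/-- A contraction applied to a generator product (p5's `contr_gen_mul` with the dual basis evaluated). -/
theorem contr_dual_gen_mul (j j' : Gen ι) (x : A ι) :
    contr (dual j) (gen j' * x) = (if j = j' then x else 0) - gen j' * contr (dual j) x := by
  rw [contr_gen_mul, dual_single]
  split_ifs <;> simp

omit [DecidableEq ι] in
/-- Mathlib's `contractLeft_ι_mul` in the model's vocabulary. -/
theorem contr_ι_mul (d : Module.Dual ℂ (V ι)) (v : V ι) (x : A ι) :
    contr d (ExteriorAlgebra.ι ℂ v * x) = d v • x - ExteriorAlgebra.ι ℂ v * contr d x :=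
  CliffordAlgebra.contractLeft_ι_mul d v x

omit [DecidableEq ι] in
/-- The contraction of a scalar vanishes. -/
theorem contr_algebraMap (d : Module.Dual ℂ (V ι)) (r : ℂ) :
    contr d (algebraMap ℂ (A ι) r) = 0 := by
  simp [contr, CliffordAlgebra.contractLeft_algebraMap]

/-- A contraction kills `⋀^0`. -/
theorem contr_eq_zero_of_mem_zero (d : Module.Dual ℂ (V ι)) {x : A ι} (hx : x ∈ grading ι 0) :
    contr d x = 0 := by
  change x ∈ LinearMap.range (ExteriorAlgebra.ι ℂ (M := V ι)) ^ 0 at hx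
  rw [pow_zero, Submodule.mem_one] at hx
  obtain ⟨r, rfl⟩ := hx
  exact contr_algebraMap d r

/-- A contraction lowers the degree by one: `contr d (⋀^n) ⊆ ⋀^{n-1}` (truncated subtraction; on
`⋀^0` the image is `0`). -/
theorem contr_mem_grading_pred (d : Module.Dual ℂ (V ι)) {n : ℕ} {x : A ι}
    (hx : x ∈ grading ι n) : contr d x ∈ grading ι (n - 1) := by
  change x ∈ LinearMap.range (ExteriorAlgebra.ι ℂ (M := V ι)) ^ n at hx
  refine Submodule.pow_induction_on_left' (LinearMap.range (ExteriorAlgebra.ι ℂ (M := V ι)))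
    (C := fun n x _ => contr d x ∈ LinearMap.range (ExteriorAlgebra.ι ℂ (M := V ι)) ^ (n - 1))
    ?_ ?_ ?_ hx
  · intro r
    simp [contr_algebraMap]
  · intro x y i hx hy ihx ihy
    simpa [map_add] using Submodule.add_mem _ ihx ihy
  · intro m hm i x hx ih
    obtain ⟨v, rfl⟩ := LinearMap.mem_range.mp hm
    rw [contr_ι_mul]
    refine Submodule.sub_mem _ (Submodule.smul_mem _ _ ?_) ?_
    · simpa using hx
    · rcases i with _ | i
      · have h0 : contr d x = 0 := contr_eq_zero_of_mem_zero d (x := x) (by simpa using hx)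
        simp [h0]
      · have h1 : (ExteriorAlgebra.ι ℂ) v ∈ LinearMap.range (ExteriorAlgebra.ι ℂ (M := V ι)) :=
          LinearMap.mem_range_self _ v
        have := Submodule.mul_mem_mul h1 (by simpa using ih :
          contr d x ∈ LinearMap.range (ExteriorAlgebra.ι ℂ (M := V ι)) ^ i)
        simpa [pow_succ'] using this

/-- `contr d` maps `⋀^{k+1}` into `⋀^k`. -/
theorem contr_mem_grading (d : Module.Dual ℂ (V ι)) {k : ℕ} {x : A ι}
    (hx : x ∈ grading ι (k + 1)) : contr d x ∈ grading ι k := by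
  simpa using contr_mem_grading_pred d hx

/-- `Λ_p` maps `⋀^{k+2}` into `⋀^k`. -/
theorem lamAt_mem_grading (p : ι) {k : ℕ} {x : A ι} (hx : x ∈ grading ι (k + 2)) :
    lamAt p x ∈ grading ι k := by
  rw [lamAt_apply]
  exact contr_mem_grading _ (contr_mem_grading _ hx)

/-- `Λ_p` kills `⋀^0` and `⋀^1`. -/
theorem lamAt_eq_zero_of_mem_lt_two (p : ι) {k : ℕ} (hk : k < 2) {x : A ι}
    (hx : x ∈ grading ι k) : lamAt p x = 0 := by
  rw [lamAt_apply]
  rcases k with _ | _ | k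
  · rw [contr_eq_zero_of_mem_zero _ hx, map_zero]
  · exact contr_eq_zero_of_mem_zero _ (contr_mem_grading _ hx)
  · omega

/-- `Λ` maps `⋀^{k+2}` into `⋀^k`. -/
theorem lam_mem_grading [Fintype ι] (c : ι → ℂ) {k : ℕ} {x : A ι} (hx : x ∈ grading ι (k + 2)) :
    lam c x ∈ grading ι k := by
  rw [lam_apply]
  exact Submodule.sum_mem _ fun p _ => Submodule.smul_mem _ _ (lamAt_mem_grading p hx)

/-- `Λ` kills `⋀^0` and `⋀^1`. -/
theorem lam_eq_zero_of_mem_lt_two [Fintype ι] (c : ι → ℂ) {k : ℕ} (hk : k < 2) {x : A ι}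
    (hx : x ∈ grading ι k) : lam c x = 0 := by
  rw [lam_apply]
  exact Finset.sum_eq_zero fun p _ => by rw [lamAt_eq_zero_of_mem_lt_two p hk hx, smul_zero]

/-- `θ ∈ ⋀^2`. -/
theorem theta_mem_two [Fintype ι] (c : ι → ℂ) : theta c ∈ grading ι 2 := by
  unfold theta
  exact Submodule.sum_mem _ fun p _ => Submodule.smul_mem _ _ (E_mem_two p)

/-- `L` maps `⋀^k` into `⋀^{k+2}`. -/
theorem lef_mem_grading [Fintype ι] (c : ι → ℂ) {k : ℕ} {x : A ι} (hx : x ∈ grading ι k) :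
    lef c x ∈ grading ι (k + 2) := by
  rw [lef_apply, add_comm]
  exact SetLike.mul_mem_graded (theta_mem_two c) hx

/-- `L^m` maps `⋀^k` into `⋀^{k+2m}`. -/
theorem lef_pow_mem_grading [Fintype ι] (c : ι → ℂ) (m : ℕ) {k : ℕ} {x : A ι}
    (hx : x ∈ grading ι k) : (lef c ^ m) x ∈ grading ι (k + 2 * m) := by
  induction m generalizing k x with
  | zero => simpa using hx
  | succ m ih =>
    rw [pow_succ, Module.End.mul_apply]
    have := ih (lef_mem_grading c hx)
    convert this using 2
    ring

/-- The basis expansion `ι v = Σ_j v_j • gen j`. -/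
theorem ι_eq_sum [Fintype ι] (v : V ι) :
    ExteriorAlgebra.ι ℂ v = ∑ j : Gen ι, v j • gen j := by
  conv_lhs => rw [← Finset.univ_sum_single v]
  rw [map_sum]
  refine Finset.sum_congr rfl fun j _ => ?_
  rw [gen, ← map_smul]
  congr 1
  ext i
  simp [Pi.single_apply]

/-- Anticommutation of a generator with `ι v`. -/
theorem gen_mul_ι (j : Gen ι) (v : V ι) :
    gen j * ExteriorAlgebra.ι ℂ v = -(ExteriorAlgebra.ι ℂ v * gen j) := by
  rw [gen, eq_neg_iff_add_eq_zero]
  exact ExteriorAlgebra.ι_add_mul_swap _ _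

/-- THE NUMBER OPERATOR acts as `k` on `⋀^k`: `Σ_j gen j ∧ ι_{j^*} x = k • x`. -/
theorem numOp_eq_smul [Fintype ι] {k : ℕ} {x : A ι} (hx : x ∈ grading ι k) :
    numOp x = (k : ℂ) • x := by
  change x ∈ LinearMap.range (ExteriorAlgebra.ι ℂ (M := V ι)) ^ k at hx
  refine Submodule.pow_induction_on_left' (LinearMap.range (ExteriorAlgebra.ι ℂ (M := V ι)))
    (C := fun k x _ => numOp x = (k : ℂ) • x) ?_ ?_ ?_ hx
  · intro r
    simp [numOp_apply, contr_algebraMap]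
  · intro x y i hx hy ihx ihy
    rw [map_add, ihx, ihy, smul_add]
  · intro m hm i x hx ih
    obtain ⟨v, rfl⟩ := LinearMap.mem_range.mp hm
    have key : ∀ j : Gen ι, gen j * contr (dual j) (ExteriorAlgebra.ι ℂ v * x) =
        v j • (gen j * x) + ExteriorAlgebra.ι ℂ v * (gen j * contr (dual j) x) := by
      intro j
      simp only [contr_ι_mul, mul_sub, mul_smul_comm, ← mul_assoc, gen_mul_ι, neg_mul,
        sub_neg_eq_add, dual, LinearMap.proj_apply]
    rw [numOp_apply]
    simp_rw [key]
    rw [Finset.sum_add_distrib, ← Finset.mul_sum, ← numOp_apply, ih]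
    simp_rw [← smul_mul_assoc]
    rw [← Finset.sum_mul, ← ι_eq_sum, mul_smul_comm, Nat.cast_succ, add_smul, one_smul, add_comm,
      add_mul, smul_mul_assoc]

/-- `Λ_q` past `E_p ∧ ·`: for `q ≠ p` they commute; for `q = p` the commutator is
`x − b_p ∧ ι_{b_p^*} x − a_p ∧ ι_{a_p^*} x`. -/
theorem lamAt_E_mul (q p : ι) (x : A ι) :
    lamAt q (E p * x) = E p * lamAt q x +
      if q = p then x - gen (p, true) * contr (dual (p, true)) x -
        gen (p, false) * contr (dual (p, false)) x else 0 := by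
  rw [lamAt_apply, lamAt_apply, E, mul_assoc]
  by_cases h : q = p
  · subst h
    simp [contr_dual_gen_mul, mul_sub, mul_assoc]
    abel
  · have h1 : ((q, true) : Gen ι) ≠ (p, false) := by simp
    have h2 : ((q, false) : Gen ι) ≠ (p, false) := by simp [h]
    have h3 : ((q, true) : Gen ι) ≠ (p, true) := by simp [h]
    have h4 : ((q, false) : Gen ι) ≠ (p, true) := by simp
    simp [contr_dual_gen_mul, h1, h2, h3, h4, h, mul_assoc]

/-- The per-plane contributions of the commutator sum to `|ι| • x − numOp x`. -/
theorem sum_plane_commutator [Fintype ι] (x : A ι) :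
    ∑ p : ι, (x - gen (p, true) * contr (dual (p, true)) x -
      gen (p, false) * contr (dual (p, false)) x) =
      (Fintype.card ι : ℂ) • x - numOp x := by
  rw [numOp_apply, Fintype.sum_prod_type]
  simp only [Fintype.sum_bool, Finset.sum_sub_distrib, Finset.sum_add_distrib, Finset.sum_const,
    Finset.card_univ, Nat.cast_smul_eq_nsmul]
  abel

/-- THE COMMUTATOR `[Λ, L] = |ι| − k` on `⋀^k`, for every coefficient vector with all `c_p ≠ 0`:
`Λ (L x) − L (Λ x) = (|ι| − k) • x`. -/
theorem lam_lef_sub_lef_lam [Fintype ι] {c : ι → ℂ} (hc : ∀ p, c p ≠ 0) {k : ℕ} {x : A ι}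
    (hx : x ∈ grading ι k) :
    lam c (lef c x) - lef c (lam c x) = ((Fintype.card ι : ℂ) - k) • x := by
  have hθ : ∀ y : A ι, theta c * y = ∑ p, c p • (E p * y) := fun y => by
    simp [theta, Finset.sum_mul]
  have hL : lam c (lef c x) = ∑ q, ∑ p, ((c q)⁻¹ * c p) • lamAt q (E p * x) := by
    rw [lef_apply, hθ, lam_apply]
    simp only [map_sum, map_smul, Finset.smul_sum, smul_smul]
  have hR : lef c (lam c x) = ∑ q, ∑ p, ((c q)⁻¹ * c p) • (E p * lamAt q x) := by
    rw [lam_apply, lef_apply, Finset.mul_sum]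
    refine Finset.sum_congr rfl fun q _ => ?_
    rw [mul_smul_comm, hθ, Finset.smul_sum]
    refine Finset.sum_congr rfl fun p _ => ?_
    rw [smul_smul]
  rw [hL, hR, ← Finset.sum_sub_distrib]
  simp_rw [← Finset.sum_sub_distrib, ← smul_sub, lamAt_E_mul, add_sub_cancel_left, smul_ite,
    smul_zero, Finset.sum_ite_eq, Finset.mem_univ, if_true]
  simp_rw [inv_mul_cancel₀ (hc _), one_smul]
  rw [sum_plane_commutator, numOp_eq_smul hx, sub_smul]

end Summit.Ventures.HodgeRepro2.A2HardLefschetzOps
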